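import Summits.HodgeConjecture.HodgeConjecture.Theses.HeckePrymWeil
import Summits.HodgeConjecture.HodgeConjecture.Theorems.HeckePrymWeilWeilSixfoldsSqrtMinus7UntwistingLemmas
import Literature.AlgebraicGeometry.Motives.AbelianVarietyProduct
import Literature.AlgebraicGeometry.Motives.AbelianVarietyProductDimProofs
import Literature.AlgebraicGeometry.Motives.AbelianVarietyCohomologyExteriorH1
import Literature.AlgebraicGeometry.Motives.AimedSplitProductProofs
import Literature.AlgebraicGeometry.HodgeTheory.AbelianVarietyPullbackAlgebraicClasses
import Literature.AlgebraicGeometry.HodgeTheory.HodgeTypeExteriorProduct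
import Literature.AlgebraicGeometry.HodgeTheory.HodgeTypeConjugation
import HarnessLib

/-!
# Untwisting for the real-quadratic base change of a `ℚ(√-7)`-Weil sixfold

Route `HeckePrymWeil` of the Hodge summit, crux `WeilSixfoldsSqrtMinus7` (stmt-HodgeConjecture-1260),
line `real-quadratic-base-change`, stub `stub_untwisting` (the lever's DESCENT half).

A `ℚ(√-7)`-Weil sixfold `(A, φ)` is base-changed along the real quadratic field `F = ℚ(√t)`
(`t > 0`) to the 12-fold `B = A ⊗_ℤ O_F = A × A`, carrying `ψ_K = φ × φ = prodLift (fst ≫ φ) (snd ≫ φ)`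
and `ψ_F = prodLift (t • snd) fst : (x, y) ↦ (t y, x)`; `L = ℚ(√-7, √t)`. The `L`-WEIL SPAN of
`H⁶(B(ℂ); ℂ)` is the join of the four joint eigenspaces `E_K^± ⊓ E_F^±` of `T_K = (𝟙 + ψ_K)^*`,
`T_F = (𝟙 + ψ_F)^*` (eigenvalues `(1 ± i√7)⁶`, `(1 ± √t)⁶`). UNTWISTING (`stub_untwisting`): if every
rational `(3,3)` class of the `L`-Weil span of `B` is algebraic, then every rational `(3,3)` class `c`
of the `K`-Weil plane `E⁺(A, φ) ⊔ E⁻(A, φ) ⊆ H⁶(A(ℂ); ℂ)` is algebraic (B. van Geemen, LNM 1594 (1994),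
4.9 and the proof of Thm. 6.12: `W_K(A) ⊗ F = W_L(A ⊗ O_F)`; E. Markman, arXiv:2509.23079, §1.1).

## The proof (no Künneth decomposition is used)

Write `g_{a,b} = a • fst + b • snd : A × A ⟶ A` (`a, b ∈ ℕ`) and `S_{a,b} = g_{a,b}^*` on `H⁶`.
* Category identities (`Preadditive`): `(𝟙 + ψ_K) ≫ g_{a,b} = g_{a,b} ≫ (𝟙 + φ)`,
  `(𝟙 + ψ_F) ≫ g_{a,b} = g_{a+b, ta+b}`, `ι ≫ g_{a,b} = a • 𝟙` for the section `ι = (𝟙, 0)`, and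
  `ψ_K ψ_F = ψ_F ψ_K` (`psiK_comp_linComb`, `psiF_comp_linComb`, `section_comp_linComb`,
  `one_add_psiK_comm_one_add_psiF`).
* POLYNOMIALITY (`exists_coeff_map_nsmul_fst_add_nsmul_snd`): `S_{a,b} y = Σ_{k ≤ 6} a^{6-k} b^k • C_k`
  for classes `C_k` depending on `y` only — `H⁶(A) = ⋀⁶ H¹(A)` is spanned by cup products of degree-one classes
  (`abelianVarietyCohomologyExteriorH1_holds`, Hopf), pull-back is multiplicative
  (`complexBetti_map_cupPowOne`) and ADDITIVE IN THE HOMOMORPHISM on `H¹`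
  (`complexBetti_map_add_deg_one`, Mumford §1), and `cupPowOne` is multilinear.
* `K`-part: `S_{a,b}` maps `E^±(A)` into `E_K^±(B)` (`map_linComb_mem_eigenspace`).
* `F`-part (`sum_pow_smul_mem_eigenspace`): from `T_F S_{1,n} y = S_{1+n, t+n} y` and Vandermonde
  (`eq_zero_of_forall_sum_pow_smul_eq_zero`), `T_F C_k = Σ_j e_{kj} C_j` with `e_{kj}` the
  coefficients of `(1+X)^{6-j}(t+X)^j`; evaluating at `X = ±√t` (`t ± √t = ±√t (1 ± √t)`) shows
  `x_± = Σ_k (±√t)^k C_k ∈ E_F^±`; and `c̃_y := Σ_m a_m S_{1,m} y = x₊ + x₋` for rational weights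
  `a_m` with `Σ_m a_m m^k = (√t)^k + (-√t)^k` (`exists_rat_weights`, Vandermonde over `ℚ`).
* Joint membership for the commuting `T_K`, `T_F` (`mem_inf_sup_inf_of_commute`; the eigenvalues
  `(1 ± √t)⁶` are distinct for `t > 0`, `one_add_sqrt_pow_six_ne`).
* `c̃ = c̃_{c₊} + c̃_{c₋}` is rational and `(3,3)` (pull-backs, rational combinations), hence
  algebraic by hypothesis; `ι^* c̃ = (Σ_m a_m) c = 2c` and `ι^*` preserves algebraic classes
  (`map_mem_algebraicClasses_of_abelianVariety`, Kleiman translate — no flatness needed).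

The generic ingredients (the bullet points above, up to the assembly) are the companion file
`HeckePrymWeilWeilSixfoldsSqrtMinus7UntwistingLemmas`; this file assembles the stub. Everything is
proved; no definition and no named fact is introduced. Relies on: nothing unproved.

## References

* [vanGeemen1994HodgeAV] B. van Geemen, An introduction to the Hodge conjecture for abelian
  varieties, LNM 1594 (1994), 4.9, Lemma 5.2, Thm. 6.12.
* [Markman2025SecantRealMultiplication] E. Markman, arXiv:2509.23079, §1.1.
* [MumfordAV1970] D. Mumford, Abelian Varieties (1970), §1.
* [LangeBirkenhake1992] H. Lange, Ch. Birkenhake, Complex Abelian Varieties (1992), Lemma 1.1.17.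
-/

noncomputable section
-- single-problem summit (Problem = Summit): the mandated namespace repeats `HodgeConjecture`.
set_option linter.dupNamespace false

open CategoryTheory
open Literature.AlgebraicGeometry.Motives Literature.AlgebraicGeometry.HodgeTheory
open Literature.AlgebraicGeometry.Motives.AbelianVariety
open Literature.AlgebraicTopology.SingularHomology Literature.Geometry.Kaehler

namespace Summit.HodgeConjecture.HodgeConjecture.Theorems.WeilSixfoldsSqrtMinus7.RealQuadraticBaseChange

/-! ### The stub -/

/-- **STUB `stub_untwisting` (UNTWISTING, the descent half of the real-quadratic base change;
van Geemen 1994, 4.9 and the proof of Thm. 6.12: `W_K(A) ⊗ F = W_L(A ⊗ O_F)`).** For a complex abelian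
sixfold `(A, φ)`, `φ ≫ φ = -7`, and `t > 0`: if every rational `(3,3)` class of `H⁶((A × A)(ℂ); ℂ)` in
the `L`-Weil span of `(A × A, ψ_K = φ × φ, ψ_F = prodLift (t • snd) fst)` — the join of the four joint
eigenspaces of `(𝟙 + ψ_K)^*`, `(𝟙 + ψ_F)^*` for `(1 ± i√7)⁶`, `(1 ± √t)⁶` — is algebraic, then every
rational `(3,3)` class `c` of the `K`-Weil plane `Eig((𝟙+φ)^*, (1+i√7)⁶) ⊔ Eig((𝟙+φ)^*, (1-i√7)⁶)` of
`H⁶(A(ℂ); ℂ)` is algebraic. Proof: lift `c` to `c̃ = Σ_{m ≤ 6} a_m (fst + m • snd)^* c` with rational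
Vandermonde weights `Σ_m a_m m^k = (√t)^k + (-√t)^k`; `c̃` is rational and `(3,3)` and lies in the
`L`-Weil span (`K`-part `map_linComb_mem_eigenspace`, `F`-part `sum_pow_smul_mem_eigenspace` through the
polynomiality `exists_coeff_map_nsmul_fst_add_nsmul_snd`, joint membership `mem_inf_sup_inf_of_commute`), hence is
algebraic; pulling back along the section `ι = (𝟙, 0)` (`map_mem_algebraicClasses_of_abelianVariety`)
gives `ι^* c̃ = 2 c` algebraic. The hypothesis `φ ≫ φ = -7` is not used.
[cite: vanGeemen1994HodgeAV, 4.9 and Thm. 6.12] -/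
theorem stub_untwisting :
    ∀ (A : AbelianVariety ℂ) (φ : A ⟶ A), A.dim = 6 → φ ≫ φ = -((7 : ℤ) • 𝟙 A) → ∀ t : ℕ, 0 < t →
      (∀ c : complexBetti (A.prod A).X 6, IsRationalClass c → IsOfHodgeType 12 (A.prod A).X 6 3 3 c →
        c ∈ ((Module.End.eigenspace (complexBetti.map (𝟙 (A.prod A) +
                  prodLift (fst A A ≫ φ) (snd A A ≫ φ)).hom.hom.hom 6).hom
                  ((1 + Complex.I * (Real.sqrt (7 : ℝ) : ℂ)) ^ 6) ⊓
                Module.End.eigenspace (complexBetti.map (𝟙 (A.prod A) +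
                  prodLift ((t : ℤ) • snd A A) (fst A A)).hom.hom.hom 6).hom
                  ((1 + (Real.sqrt (t : ℝ) : ℂ)) ^ 6)) ⊔
              (Module.End.eigenspace (complexBetti.map (𝟙 (A.prod A) +
                  prodLift (fst A A ≫ φ) (snd A A ≫ φ)).hom.hom.hom 6).hom
                  ((1 + Complex.I * (Real.sqrt (7 : ℝ) : ℂ)) ^ 6) ⊓
                Module.End.eigenspace (complexBetti.map (𝟙 (A.prod A) +
                  prodLift ((t : ℤ) • snd A A) (fst A A)).hom.hom.hom 6).hom
                  ((1 - (Real.sqrt (t : ℝ) : ℂ)) ^ 6))) ⊔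
             ((Module.End.eigenspace (complexBetti.map (𝟙 (A.prod A) +
                  prodLift (fst A A ≫ φ) (snd A A ≫ φ)).hom.hom.hom 6).hom
                  ((1 - Complex.I * (Real.sqrt (7 : ℝ) : ℂ)) ^ 6) ⊓
                Module.End.eigenspace (complexBetti.map (𝟙 (A.prod A) +
                  prodLift ((t : ℤ) • snd A A) (fst A A)).hom.hom.hom 6).hom
                  ((1 + (Real.sqrt (t : ℝ) : ℂ)) ^ 6)) ⊔
              (Module.End.eigenspace (complexBetti.map (𝟙 (A.prod A) +
                  prodLift (fst A A ≫ φ) (snd A A ≫ φ)).hom.hom.hom 6).hom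
                  ((1 - Complex.I * (Real.sqrt (7 : ℝ) : ℂ)) ^ 6) ⊓
                Module.End.eigenspace (complexBetti.map (𝟙 (A.prod A) +
                  prodLift ((t : ℤ) • snd A A) (fst A A)).hom.hom.hom 6).hom
                  ((1 - (Real.sqrt (t : ℝ) : ℂ)) ^ 6))) →
        c ∈ algebraicClasses (A.prod A).X 3) →
      ∀ c : complexBetti A.X 6, IsRationalClass c → IsOfHodgeType 6 A.X 6 3 3 c →
        c ∈ Module.End.eigenspace (complexBetti.map (𝟙 A + φ).hom.hom.hom 6).hom
              ((1 + Complex.I * (Real.sqrt (7 : ℝ) : ℂ)) ^ 6) ⊔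
            Module.End.eigenspace (complexBetti.map (𝟙 A + φ).hom.hom.hom 6).hom
              ((1 - Complex.I * (Real.sqrt (7 : ℝ) : ℂ)) ^ 6) →
        c ∈ algebraicClasses A.X 3 := by
  intro A φ hA _ t ht H c hrat hH hmem
  classical
  -- the two operators on `H⁶(A × A)` and their `F`-eigenvalues
  set TK : Module.End ℂ (complexBetti (A.prod A).X 6) :=
    (complexBetti.map (𝟙 (A.prod A) + prodLift (fst A A ≫ φ) (snd A A ≫ φ)).hom.hom.hom 6).hom with hTK
  set TF : Module.End ℂ (complexBetti (A.prod A).X 6) :=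
    (complexBetti.map (𝟙 (A.prod A) + prodLift ((t : ℤ) • snd A A) (fst A A)).hom.hom.hom 6).hom with hTF
  set st : ℂ := ((Real.sqrt (t : ℝ) : ℝ) : ℂ) with hst
  have hsq : st ^ 2 = (t : ℂ) := by
    rw [hst, ← Complex.ofReal_pow, Real.sq_sqrt (Nat.cast_nonneg _), Complex.ofReal_natCast]
  have hne : (1 + st) ^ 6 ≠ (1 - st) ^ 6 := one_add_sqrt_pow_six_ne t ht
  have hcomm : Commute TK TF := by
    refine LinearMap.ext fun x => ?_
    show complexBetti.map _ 6 (complexBetti.map _ 6 x) = complexBetti.map _ 6 (complexBetti.map _ 6 x)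
    rw [complexBetti_map_map_hom, complexBetti_map_map_hom, one_add_psiK_comm_one_add_psiF]
  -- smooth projectivity and a Hodge model of `A × A`
  have hA6 : IsSmoothProjective 6 A.X := by
    have h := AbelianVariety.isSmoothProjective_holds (A := A)
    rw [AbelianVariety.isSmoothProjective, hA] at h
    exact h
  have hB12 : IsSmoothProjective 12 (A.prod A).X := by
    have h := AbelianVariety.isSmoothProjective_holds (A := A.prod A)
    rw [AbelianVariety.isSmoothProjective, dim_prod, hA] at h
    exact h
  obtain ⟨M⟩ := nonempty_hodgeModel_holds (n := 12) (X := (A.prod A).X) hB12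
  -- the rational Vandermonde weights `Σ_m a_m m^k = (√t)^k + (-√t)^k`
  obtain ⟨a, ha⟩ := exists_rat_weights (N := 7)
    (fun k => if Even (k : ℕ) then 2 * (t : ℚ) ^ ((k : ℕ) / 2) else 0)
  have ha' : ∀ k : Fin 7, ∑ m : Fin 7, ((a m : ℚ) : ℂ) * ((m : ℕ) : ℂ) ^ (k : ℕ) =
      st ^ (k : ℕ) + (-st) ^ (k : ℕ) := by
    intro k
    rw [hst, sqrt_pow_add_neg_sqrt_pow, ← ha k]
    push_cast
    rfl
  have hsum : ∑ m : Fin 7, ((a m : ℚ) : ℂ) = 2 := by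
    have h := ha' 0
    simp only [Fin.val_zero, pow_zero, mul_one] at h
    rw [h]
    norm_num
  -- the lift `L y = Σ_m a_m • (fst + m • snd)^* y`
  set L : complexBetti A.X 6 →ₗ[ℂ] complexBetti (A.prod A).X 6 :=
    ∑ m : Fin 7, ((a m : ℚ) : ℂ) •
      (complexBetti.map ((1 : ℕ) • fst A A + (m : ℕ) • snd A A).hom.hom.hom 6).hom with hL
  have hLy : ∀ y, L y = ∑ m : Fin 7, ((a m : ℚ) : ℂ) •
      complexBetti.map ((1 : ℕ) • fst A A + (m : ℕ) • snd A A).hom.hom.hom 6 y := by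
    intro y
    rw [hL, LinearMap.sum_apply]
    rfl
  -- joint membership of `L y` for an eigenvector `y` of `(𝟙 + φ)^*`
  have hjoint : ∀ (μ : ℂ) (y : complexBetti A.X 6),
      y ∈ Module.End.eigenspace (complexBetti.map (𝟙 A + φ).hom.hom.hom 6).hom μ →
      L y ∈ (Module.End.eigenspace TK μ ⊓ Module.End.eigenspace TF ((1 + st) ^ 6)) ⊔
        (Module.End.eigenspace TK μ ⊓ Module.End.eigenspace TF ((1 - st) ^ 6)) := by
    intro μ y hy
    refine mem_inf_sup_inf_of_commute hcomm hne ?_ ?_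
    · -- `K`-part
      rw [hLy]
      exact Submodule.sum_mem _ fun m _ =>
        Submodule.smul_mem _ _ (map_linComb_mem_eigenspace φ hy 1 m)
    · -- `F`-part
      obtain ⟨C', hC⟩ := exists_coeff_map_nsmul_fst_add_nsmul_snd A 6 y
      have hT : ∀ n : Fin 7, TF (∑ k : Fin 7, (((n : ℕ) : ℂ) ^ (k : ℕ)) • C' k) =
          ∑ k : Fin 7, ((1 + ((n : ℕ) : ℂ)) ^ (6 - (k : ℕ)) * ((t : ℂ) + ((n : ℕ) : ℂ)) ^ (k : ℕ)) •
            C' k := by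
        intro n
        have h1 : ∑ k : Fin 7, (((n : ℕ) : ℂ) ^ (k : ℕ)) • C' k =
            complexBetti.map ((1 : ℕ) • fst A A + (n : ℕ) • snd A A).hom.hom.hom 6 y := by
          rw [hC]
          simp only [Nat.cast_one, one_pow, one_mul]
        rw [h1]
        show complexBetti.map _ 6 (complexBetti.map _ 6 y) = _
        rw [map_one_add_psiF_map_linComb, hC]
        simp only [Nat.cast_add, Nat.cast_one, mul_one]
      have hLy' : L y = ∑ k : Fin 7, (st ^ (k : ℕ)) • C' k + ∑ k : Fin 7, ((-st) ^ (k : ℕ)) • C' k := by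
        rw [hLy, ← Finset.sum_add_distrib]
        simp_rw [hC, ← add_smul, ← ha']
        simp only [Nat.cast_one, one_pow, one_mul]
        exact sum_smul_sum_smul_eq _ _ _
      rw [hLy']
      refine Submodule.add_mem_sup (sum_pow_smul_mem_eigenspace TF (t : ℂ) C' hT st hsq) ?_
      have h := sum_pow_smul_mem_eigenspace TF (t : ℂ) C' hT (-st) (by rw [neg_sq, hsq])
      rwa [← sub_eq_add_neg] at h
  -- `L c` lies in the `L`-Weil span
  obtain ⟨cp, hcp, cm, hcm, hc⟩ := Submodule.mem_sup.1 hmem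
  have hspan := Submodule.add_mem_sup (hjoint _ cp hcp) (hjoint _ cm hcm)
  rw [← map_add, hc] at hspan
  -- `L c` is rational and of Hodge type `(3,3)`
  have hLrat : IsRationalClass (L c) := by
    rw [hLy]
    exact IsRationalClass.sum_smul _ (fun m => hrat.pullback _) a
  have hLH : IsOfHodgeType 12 (A.prod A).X 6 3 3 (L c) := by
    rw [hLy]
    exact IsOfHodgeType.sum hB12 M _ _ fun m _ =>
      (hH.map_of_isSmoothProjective hB12 hA6 _).smul _
  -- hence algebraic, and so is its pull-back along the section `ι = (𝟙, 0)`, which is `2 • c`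
  have halg : L c ∈ algebraicClasses (A.prod A).X 3 := H (L c) hLrat hLH hspan
  have hι := map_mem_algebraicClasses_of_abelianVariety hA6 (A.prod A)
    (prodLift (𝟙 A) (0 : A ⟶ A)).hom.hom.hom halg
  have hι' : complexBetti.map (prodLift (𝟙 A) (0 : A ⟶ A)).hom.hom.hom 6 (L c) = (2 : ℂ) • c := by
    rw [hLy, map_sum]
    have hm : ∀ m : Fin 7, complexBetti.map (prodLift (𝟙 A) (0 : A ⟶ A)).hom.hom.hom 6
        (((a m : ℚ) : ℂ) • complexBetti.map ((1 : ℕ) • fst A A + (m : ℕ) • snd A A).hom.hom.hom 6 c) =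
        ((a m : ℚ) : ℂ) • c := by
      intro m
      rw [map_smul, map_section_map_linComb]
    simp_rw [hm]
    rw [← Finset.sum_smul, hsum]
  have h2 : c = (2 : ℂ)⁻¹ • complexBetti.map (prodLift (𝟙 A) (0 : A ⟶ A)).hom.hom.hom 6 (L c) := by
    rw [hι', smul_smul, inv_mul_cancel₀ (two_ne_zero), one_smul]
  rw [h2]
  exact Submodule.smul_mem _ _ hι


end Summit.HodgeConjecture.HodgeConjecture.Theorems.WeilSixfoldsSqrtMinus7.RealQuadraticBaseChange

end
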